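import Summits.BirchSwinnertonDyer.BirchSwinnertonDyer.Theorems.KimAtThreeTwoExponentWitnessPair
import Summits.BirchSwinnertonDyer.Rank1Residual.GaloisImage.KatoKuriharaPortThreeOfZetaBodyOfValueRows
import HarnessLib

/-!
# Route `KimAtThreeKolyvagin` (rung W2), additive-DEFECT rows of cruxes 19562 / 19599 / 19679:
# ★₂ — PORT₂ `KatoKuriharaPortThreeAtWith₂TwoExp W 0 e v₃ η P` FROM KATO'S EULER SYSTEM, modulo the
# two-exponent rider and the value rows (the additive-defect twin of n1011's ★ PK-6₂)

Cell `bsd-addord`, seat `bsd-addord-w2-acc6` (PROGRAMME PART 1b, plan g16 ACCEL-LIST (6)); `--supports`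
stmt-BirchSwinnertonDyer-19599 (helper; the item OWNER assembles).  END-TYPE TOOL THEOREMS WITH DISPLAYED
HYPOTHESES: no definition, no named fact, no instance, no `sorry`; nothing asserted about any curve; nothing booked;
crux 19599 stays OPEN.

## What

Seat acc6 gen 0 reduced the registered stub `stub_additiveDefect` of crux 19599 (`ShallowEqDeepOffKatoStratum`) to
ONE displayed object, PORT₂ = `KimAtThreeKolyvaginDefs.KatoKuriharaPortThreeAtWith₂TwoExp W 0 e v₃ η P` on the
additive-defect rows (`KimAtThreeShallowEqDeepOffStratumAdditiveDefectOfPort.stub_additiveDefect_of_portTwoExp`,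
p465715), and seats acc1 / acc3 consume the same PORT₂ for 19562 / 19679.  This file DISCHARGES PORT₂ at one row
from exactly the inputs of n1011's ★ PK-6₂ (`GaloisImage.katoKuriharaPortThreeAtWith₂_zero_of_zetaBody`, the
discharger of the Kato-stratum port PORT″ = crux 19560's object) with ONE change — the rider:
(a) Kato's cited matrix `ZetaBody W 3 P.f ι κK Λ c d a A z x` on DISPLAYED witnesses (the conclusion of the
PUBLISHED named fact `Kato2004.exists_eulerSystem_expStar_values`; never obtained inside an END);
(b) at every depth `j` a functional `Λfin j : H¹(ℚ₃, E[3^j·3]) →+ ℤ/3^{j+1}` with DICT3's (Λ)-clauses (onto on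
`𝓕_can(v₃)`, kernel the Kummer part) and the **TWO-EXPONENT scalar compatibility (ii₂)**
`Λ_{0,r}(y) ≡ s ⊗ 1 (mod 3^{j+1} L_int) ⟹ 3^e · Λfin(loc κ₀) = s̄` — in place of n1011's rider
`KatoExpStarFiniteLevelAt W 3 j 0 v₃ Λ (Λfin j)` whose clause (ii) (`e = 0`) is, together with (i), NOT satisfiable
by Kato's witnesses on the rows `3 ∣ c₃` (Kodaira IV/IV*: `exp*_ω(H¹(ℚ₃,T)) = 3^{v₃(c₃)−t}ℤ₃`, Kim AJM 148 §3.2.3 +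
Thm. 3.6 — the specialisation Rem. 3.7 / Lemma 3.9 printed "for `p ≥ 3`" is wrong at IV/IV*; kim3 Lemma L/L′) or
`3 ∣ c_P` (`‖Ω(W)/Ω⁺_{P.f}‖₃ = ‖c_P‖₃`, tree `exists_optimal_period_ratio`); with `e = v₃(c₃) + v₃(c_P)` and
`Λfin := ι ∘ 3^{t−e}·exp*` onto-normalised, (i) and (ii₂) are the true shape (seat diagnosis, gen 0 memo
W2ACC6-TWOEXP-g0 §1, gen 2 STATUS 2026-08-26T21:33Z);
(c) THEOREM D's row certificates `hbad` (no `3`-torsion over `ℚ_w` at bad `w ≠ 3` — crux 19560's (C3)) and `ht0`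
(`t = 0`); (d) `hcdA` (Kato's auxiliary datum avoids primes `≡ 1 (mod 3)`) with `hN : N = N_E`;
(e) the per-level VALUE ROWS at `t = 0` — displayed in ★₂, DISCHARGED in ★₂′ by n1011-p02's
`ValueRow.valueRows_of_zetaBody` from its level-free certificates (`hNorm`: Kato's constant is a rational
`3`-unit; `d′`, `gcd`, `A ⟂ N`, `9 ∣ N`, integer models of `a_q`, the two unit certificates).

* ★₂ `katoKuriharaPortThreeAtWith₂TwoExp_zero_of_zetaBody` — PORT₂ from (a)–(e), value rows displayed.
* ★₂′ `katoKuriharaPortThreeAtWith₂TwoExp_zero_of_zetaBody_of_valueRows` — value rows discharged.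
Proof: unfold PORT₂ (acc6's `KatoKuriharaDictionaryThreeAt₂AtTwoExp` antecedents `k ≤ k′`, pin, `Addv`, surj(3),
`#E(ℚ₃)[3] = 3^0`, `v₃ ∣ 3`); the With-guards give THEOREM D's `hT`/`hC`, their deep classes give Kolyvagin primes
of levels `k+1`, `k′+1` (`KolyvaginPrime.isKolyvaginPrime_of_mem_frobeniusClassPrimes_of_le`), `hcdA` + `hN` make
them usable, `ht0` gives `𝓕_can,3 = ⊤` at every depth (`propagatedSelmerStructure_three_eq_top_of_torsion_eq_zero`),
then this seat's `KimAtThreeTwoExponentWitnessPair.exists_katoKuriharaWitnessAtTwoExp_pair_of_zetaBody`.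
NET EFFECT for the planner: the additive-defect rows of 19562 / 19599 / 19679 carry EXACTLY crux 19560's residual
inputs (C1) fine Kato package [rider clause (ii) ↦ (ii₂), one exponent `e`], (C2) certificate supply, (C3) anomalous
rows — no separate PORT₂ debt line.

HONEST LIMITS: `t = 0` only; rows with a 3-anomalous bad place excluded (`hbad`); riders / `hNorm` are hypotheses
on bound witnesses (CONSTRUCTION-SHAPED, never `_holds`); closes nothing; 0 defs / 0 facts / 0 sorry.
References: [Kato2004Asterisque] (8.1.3), Prop. 8.12, §9.4, Thm. 9.7, Thm. 6.6 (1), Ex. 13.3; [Kim2022StructureSelmer]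
§2.2.2, §3.2.3, Thm. 3.6, Rem. 3.7, Lemma 3.9, §3.3–§3.4.1, Thm. 3.13; [MazurRubin2004] Def. 3.1.3, Thm. 3.2.4, App. A;
[Sakamoto2024] §2, Def. 4.1; [Rubin2000] Def. 4.4.4; [Kim2025RefinedTNC] §4.2, Rem. 4.1, §8.1.2; kim3 memo
KIM3-PROOF §4 (Lemma L/L′), KIM3-W2-PORT-g10; n1011 `cells/n1011/ROUTE-1.md` §53, §58, §60.
-/

set_option autoImplicit false
-- the Theorems namespace of a single-conjunct summit repeats the summit name by design (D-0017)
set_option linter.dupNamespace false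

noncomputable section

open scoped NumberField TensorProduct ContRepresentation Classical
open CategoryTheory Field Function Finset IsDedekindDomain NumberField WeierstrassCurve
open Rat.HeightOneSpectrum
open Literature.NumberTheory.GaloisRepresentations Literature.NumberTheory.GaloisCohomology
open Literature.NumberTheory.GaloisRepresentations.DiscreteGaloisModule
open Literature.NumberTheory.EllipticCurves Literature.NumberTheory.EllipticCurves.ModularForms
open Literature.NumberTheory.EllipticCurves.Rank1Residual
open Literature.NumberTheory.EllipticCurves.Kato2004
open Literature.NumberTheory.EllipticCurves.Kato2004.EulerSystemValues
open Summit.BirchSwinnertonDyer.Rank1Residual.GaloisImage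
open Summit.BirchSwinnertonDyer.BirchSwinnertonDyer.Theorems.KimAtThreeKolyvaginDefs
open Summit.BirchSwinnertonDyer.BirchSwinnertonDyer.Theorems.KimAtThreeTwoExponentWitnessPair

namespace Summit.BirchSwinnertonDyer.BirchSwinnertonDyer.Theorems.KimAtThreeTwoExponentPortOfZetaBody

variable (W : WeierstrassCurve ℚ) [W.IsElliptic] [W.IsGloballyMinimal]
  [ContinuousSMul ℤ_[3] (W.tateModule 3)] [Module.Free ℤ_[3] (W.tateModule 3)]
  [Module.Finite ℤ_[3] (W.tateModule 3)]

/-- Local notation: `𝐃F⟦r, τ⟧ ℓ = Σ_{j<ℓ−1} j·σ_{χ_{m(0,r)}(τ_ℓ)}^j` on the level field `ℚ(ζ_{m(0,r)})`. -/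
local notation3 (prettyPrint := false) "𝐃F⟦" r ", " τ "⟧" =>
  fun ℓ : HeightOneSpectrum (𝓞 ℚ) =>
  ∑ j ∈ Finset.range (((primesEquiv ℓ : Nat.Primes) : ℕ) - 1),
    (j : Module.End ℚ (CyclotomicField (cycLevel 3 0 r) ℚ)) *
      (sigma (cycLevel 3 0 r) (modNCyclotomicCharacter ℚ (cycLevel 3 0 r)
          ((τ : HeightOneSpectrum (𝓞 ℚ) → absoluteGaloisGroup ℚ) ℓ)) :
        CyclotomicField (cycLevel 3 0 r) ℚ →ₐ[ℚ] CyclotomicField (cycLevel 3 0 r) ℚ).toLinearMap ^ j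

/-- Local notation: the TWO-EXPONENT rider clause (ii₂) at depth `j`, torsion exponent `t`, defect exponent
`e`, place `v`, for the pair `(Λ, Λf)` (n1011's `KatoExpStarFiniteLevelAt` clause (ii), conclusion `× 3^e`). -/
local notation3 (prettyPrint := false) "RIDER₂⟦" W' ", " j ", " t' ", " e' ", " v' ", " Λ' ", " Λf "⟧" =>
  ∀ (r : Finset (HeightOneSpectrum (𝓞 ℚ)))
    (Ψ : H1 (tateRep W' 3) (cycSubgroup 3 0 r) →+
      continuousCohomology 1
        (subgroupRep (WeierstrassCurve.torsionGaloisModule W' (((3 : ℕ) : ℤ) ^ j * ((3 : ℕ) : ℤ))).toTopRep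
          (cycSubgroup 3 0 r))),
    (∀ (φ : contOneCocycles (subgroupRep (tateRep W' 3).toTopRep (cycSubgroup 3 0 r)))
        (ψ : contOneCocycles
          (subgroupRep (WeierstrassCurve.torsionGaloisModule W' (((3 : ℕ) : ℤ) ^ j * ((3 : ℕ) : ℤ))).toTopRep
            (cycSubgroup 3 0 r))),
        (∀ g, ((ψ.1 g : geomTorsion W' (((3 : ℕ) : ℤ) ^ j * ((3 : ℕ) : ℤ))) : geomPoints W') =
          TateModule.proj 3 (j + 1) (φ.1 g)) →
        Ψ (oneCocycleClass _ φ) = oneCocycleClass _ ψ) →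
    ∀ (y : H1 (tateRep W' 3) (cycSubgroup 3 0 r))
      (κ₀ : galoisCohomology (WeierstrassCurve.torsionGaloisModule W' (((3 : ℕ) : ℤ) ^ j * ((3 : ℕ) : ℤ))) 1)
      (s : ℤ_[3]),
      resSubgroup (WeierstrassCurve.torsionGaloisModule W' (((3 : ℕ) : ℤ) ^ j * ((3 : ℕ) : ℤ))).toTopRep
          (cycSubgroup 3 0 r) 1 κ₀ = Ψ y →
      galoisCohomology.localization (WeierstrassCurve.torsionGaloisModule W' (((3 : ℕ) : ℤ) ^ j * ((3 : ℕ) : ℤ)))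
          (Sum.inr v') 1 κ₀ ∈ propagatedSelmerStructure W' 3 j (Sum.inr v') →
      (∃ l ∈ cycIntLattice 3 (cycLevel 3 0 r),
          (((3 : ℕ) : ℤ_[3]) ^ t') • Λ' 0 r y - ((s : ℚ_[3]) ⊗ₜ[ℚ] (1 : CyclotomicField (cycLevel 3 0 r) ℚ)) =
            (((3 : ℕ) : ℤ_[3]) ^ (j + 1)) • (l : ℚ_[3] ⊗[ℚ] CyclotomicField (cycLevel 3 0 r) ℚ)) →
      ((3 ^ e' : ℕ) : ZMod (3 ^ (j + 1))) *
        Λf (galoisCohomology.localization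
          (WeierstrassCurve.torsionGaloisModule W' (((3 : ℕ) : ℤ) ^ j * ((3 : ℕ) : ℤ))) (Sum.inr v') 1 κ₀) =
        PadicInt.toZModPow (j + 1) s

set_option backward.isDefEq.respectTransparency false in
/-- **★₂: PORT₂ at `t = 0` from Kato's Euler system, THEOREM D, the (Λ)-clauses + two-exponent riders and the
value rows** (module docstring).  Displayed: the parametrisation datum `P` at the conductor level (`hN`), Kato's
witnesses through `hbody` for `P.f`, the functionals `Λfin j` with the (Λ)-clauses `hΛ` and the two-exponent
scalar compatibilities `hfin₂` (exponent `e`, torsion `0`), `hcdA`, THEOREM D's certificates `hbad` / `ht0`, the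
value rows `hvalue` (at `t = 0`); concluded: `KatoKuriharaPortThreeAtWith₂TwoExp W 0 e v₃ η P` for every generator
family `η`.  The additive-defect twin of n1011's ★ PK-6₂ `katoKuriharaPortThreeAtWith₂_zero_of_zetaBody`.
[cite: Kato2004Asterisque, §9.4 (p. 188), Thm. 9.7 (p. 189) and Ex. 13.3 (pp. 224–225)]
[cite: Kim2022StructureSelmer, Thm. 3.13 and §1.2.2, §2.2.2, §3.2.3, §3.3–§3.4.1 (arXiv v3 pp. 12, 16–18, 26–27)]
[cite: MazurRubin2004, Def. 3.1.3, Thm. 3.2.4 and App. A (Lemma A.1)] [cite: Sakamoto2024, §2 and Def. 4.1]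
[cite: Kim2025RefinedTNC, §4.2 and §8.1.2] -/
theorem katoKuriharaPortThreeAtWith₂TwoExp_zero_of_zetaBody
    {N : ℕ} [NeZero N] (P : ModularParametrizationData W N) (hN : N = W.conductorNorm ℤ)
    {ι : (n : ℕ) → (CyclotomicField n ℚ →+* ℂ)} {κK : ℝ}
    {Λ : ∀ (k' : ℕ) (r : Finset (HeightOneSpectrum (𝓞 ℚ))),
      H1 (tateRep W 3) (cycSubgroup 3 k' r) →ₗ[ℤ_[3]] ℚ_[3] ⊗[ℚ] CyclotomicField (cycLevel 3 k' r) ℚ}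
    {c d a : ℤ} {A : ℕ}
    {z : ∀ (k' : ℕ) (r : (cyclotomicLevelsRat 3 (badPlaces c d A N)).Ideals),
      H1 (tateRep W 3) ((cyclotomicLevelsRat 3 (badPlaces c d A N)).level k' r.1)}
    {x : ∀ (k' : ℕ) (r : (cyclotomicLevelsRat 3 (badPlaces c d A N)).Ideals),
      CyclotomicField (cycLevel 3 k' r.1) ℚ}
    (hbody : ZetaBody W 3 P.f ι κK Λ c d a A z x)
    {e : ℕ} {v₃ : HeightOneSpectrum (𝓞 ℚ)}
    (Λfin : ∀ j : ℕ, galoisCohomology ((W.torsionGaloisModule (((3 : ℕ) : ℤ) ^ j * ((3 : ℕ) : ℤ))).toLocal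
      (Sum.inr v₃)) 1 →+ ZMod (3 ^ (j + 1)))
    (hΛ : ∀ j : ℕ,
      (∀ c : ZMod (3 ^ (j + 1)), ∃ x ∈ propagatedSelmerStructure W 3 j (Sum.inr v₃), Λfin j x = c) ∧
      (∀ x ∈ propagatedSelmerStructure W 3 j (Sum.inr v₃),
        Λfin j x = 0 ↔ x ∈ W.kummerSelmerStructure (((3 : ℕ) : ℤ) ^ j * ((3 : ℕ) : ℤ)) (Sum.inr v₃)))
    (hfin₂ : ∀ j : ℕ, RIDER₂⟦W, j, 0, e, v₃, Λ, Λfin j⟧)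
    {η : (q : HeightOneSpectrum (𝓞 ℚ)) → (ZMod (Ideal.absNorm q.asIdeal))ˣ}
    -- the auxiliary datum avoids every prime `≡ 1 (mod 3)` (so every Kolyvagin prime is usable)
    (hcdA : ∀ q : ℕ, q.Prime → q ≡ 1 [MOD 3] → ¬ q ∣ 2 * c.natAbs * d.natAbs * A)
    -- THEOREM D's row certificates
    (hbad : ∀ w : HeightOneSpectrum (𝓞 ℚ), ¬ W.HasGoodReductionAt w →
      ((primesEquiv w : Nat.Primes) : ℕ) ≠ 3 →
        ∀ Q : (W.baseChange (w.adicCompletion ℚ)).toAffine.Point, 3 • Q = 0 → Q = 0)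
    (ht0 : ∀ w : HeightOneSpectrum (𝓞 ℚ), ((3 : ℕ) : 𝓞 ℚ) ∈ w.asIdeal →
        ∀ Q : (W.baseChange (w.adicCompletion ℚ)).toAffine.Point, 3 • Q = 0 → Q = 0)
    -- the per-level VALUE ROWS at `t = 0` (T-PK6-VROW's OUT), displayed
    (hvalue : ∀ (j : ℕ) (σ : HeightOneSpectrum (𝓞 ℚ) → absoluteGaloisGroup ℚ),
      (∀ q, σ q ∈ (adicCompletionPrime ℚ q).inertia (absoluteGaloisGroup ℚ)) →
      (∀ q, modNCyclotomicCharacter ℚ (Ideal.absNorm q.asIdeal) (σ q) = η q) →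
      ∀ (r : Finset (HeightOneSpectrum (𝓞 ℚ)))
        (hr : ∀ q ∈ r, q ∈ (cyclotomicLevelsRat 3 (badPlaces c d A N)).primes),
        (∀ q ∈ r, Kato.IsKolyvaginPrime W 3 (j + 1) ((primesEquiv q : Nat.Primes) : ℕ)) →
        (∀ q ∈ r, Subgroup.zpowers (η q) = ⊤) →
        ∃ (s : ℤ_[3]) (u : (ZMod (3 ^ (j + 1)))ˣ)
          (ψ : (ℓ : ℕ) → (ZMod ℓ)ˣ →* Multiplicative (ZMod (3 ^ (j + 1)))),
          (∀ q ∈ r, Function.Surjective (ψ (Ideal.absNorm q.asIdeal))) ∧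
          (∃ l ∈ cycIntLattice 3 (cycLevel 3 0 r),
            (((3 : ℕ) : ℤ_[3]) ^ (0 : ℕ)) • ((1 : ℚ_[3]) ⊗ₜ[ℚ]
              ((r.noncommProd 𝐃F⟦r, σ⟧ (ZetaValue.pairwise_commute_fieldDeriv (cycLevel 3 0 r)
                  (fun ℓ => modNCyclotomicCharacter ℚ (cycLevel 3 0 r) (σ ℓ))
                  (fun ℓ => ((primesEquiv ℓ : Nat.Primes) : ℕ) - 1) r))
                (x 0 ⟨r, hr⟩ + sigma (cycLevel 3 0 r) (-1) (x 0 ⟨r, hr⟩)))) -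
              ((s : ℚ_[3]) ⊗ₜ[ℚ] (1 : CyclotomicField (cycLevel 3 0 r) ℚ)) =
            (((3 : ℕ) : ℤ_[3]) ^ (j + 1)) • (l : ℚ_[3] ⊗[ℚ] CyclotomicField (cycLevel 3 0 r) ℚ)) ∧
          haveI : NeZero (∏ q ∈ r, Ideal.absNorm q.asIdeal) :=
            ⟨Finset.prod_ne_zero_iff.2 fun q _ h => q.ne_bot (Ideal.absNorm_eq_zero_iff.1 h)⟩
          PadicInt.toZModPow (j + 1) s = (u : ZMod (3 ^ (j + 1))) *
            ((3 : ℕ) : ZMod (3 ^ (j + 1))) ^ (0 : ℕ) *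
              kuriharaNumber P.f (3 ^ (j + 1)) (∏ q ∈ r, Ideal.absNorm q.asIdeal) ψ) :
    KatoKuriharaPortThreeAtWith₂TwoExp W 0 e v₃ η P := by
  intro k k' D D' red hDW hDW' hkk' hred _hadd hsurj _ht hv₃
  -- the guards
  obtain ⟨hT, hC, S, τ, hS, hτμ, hτq, hP⟩ := hDW
  obtain ⟨hT', hC', S', τ', hS', hτμ', hτq', hP'⟩ := hDW'
  have hirr : W.HasIrreducibleModPGaloisRep 3 :=
    hasIrreducibleModPGaloisRep_of_hasSurjectiveModNGaloisRep W 3 hsurj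
  -- Kolyvagin primes of the right levels (E1-deep on the deep classes of the guards)
  have hKol : ∀ q ∈ D.primes, Kato.IsKolyvaginPrime W 3 (k + 1) ((primesEquiv q : Nat.Primes) : ℕ) :=
    fun q hq => KolyvaginPrime.isKolyvaginPrime_of_mem_frobeniusClassPrimes_of_le W
      (Nat.le_add_right k 0) (fun v hv => (hS v hv).1) hτμ hτq (hP hq)
  have hKol' : ∀ q ∈ D'.primes, Kato.IsKolyvaginPrime W 3 (k' + 1) ((primesEquiv q : Nat.Primes) : ℕ) :=
    fun q hq => KolyvaginPrime.isKolyvaginPrime_of_mem_frobeniusClassPrimes_of_le W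
      (Nat.le_add_right k' 0) (fun v hv => (hS' v hv).1) hτμ' hτq' (hP' hq)
  -- every Kolyvagin prime is a usable prime of Kato's system for `(c, d, A, N)`
  have husable : ∀ (j : ℕ) (q : HeightOneSpectrum (𝓞 ℚ)),
      Kato.IsKolyvaginPrime W 3 (j + 1) ((primesEquiv q : Nat.Primes) : ℕ) →
        q ∈ (cyclotomicLevelsRat 3 (badPlaces c d A N)).primes := by
    intro j q hq
    have hℓ := hq.prime
    have h13 : ((primesEquiv q : Nat.Primes) : ℕ) ≡ 1 [MOD 3] :=
      hq.modEq_one.of_dvd (dvd_pow_self 3 (Nat.succ_ne_zero j))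
    refine (mem_primes_cyclotomicLevelsRat_badPlaces_iff 3 c d A N q).2 ⟨fun hdvd => ?_, hq.ne⟩
    rcases (Nat.Prime.dvd_mul hℓ).mp hdvd with h | h
    · exact hcdA _ hℓ h13 h
    · apply hq.not_dvd
      rw [← hN]
      exact dvd_mul_of_dvd_left h 3
  have hPr : D.primes ⊆ (cyclotomicLevelsRat 3 (badPlaces c d A N)).primes :=
    fun q hq => husable k q (hKol q hq)
  have hPr' : D'.primes ⊆ (cyclotomicLevelsRat 3 (badPlaces c d A N)).primes :=
    fun q hq => husable k' q (hKol' q hq)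
  -- `𝓕_can,3 = ⊤` at every depth (`t = 0`, Mazur–Rubin Lemma A.1 along the reduction tower)
  have htower : ∀ j : ℕ,
      ∃ redj : (W.torsionGaloisModule (((3 : ℕ) : ℤ) ^ (j + 1) * ((3 : ℕ) : ℤ))).toContRepresentation →ⁱL
          (W.torsionGaloisModule (((3 : ℕ) : ℤ) ^ j * ((3 : ℕ) : ℤ))).toContRepresentation,
        ∀ y : geomTorsion W (((3 : ℕ) : ℤ) ^ (j + 1) * ((3 : ℕ) : ℤ)),
          ((redj y : geomTorsion W (((3 : ℕ) : ℤ) ^ j * ((3 : ℕ) : ℤ))) : geomPoints W) =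
            ((3 : ℕ) : ℤ) • (y : geomPoints W) := by
    intro j
    obtain ⟨redj, hredj⟩ := exists_torsionReduction_three W j (j + 1)
    refine ⟨redj, fun y => ?_⟩
    rw [hredj, Nat.add_sub_cancel_left, pow_one]
  choose redT hredT using htower
  have htop : ∀ (j : ℕ) (w : HeightOneSpectrum (𝓞 ℚ)), ((primesEquiv w : Nat.Primes) : ℕ) = 3 →
      propagatedSelmerStructure W 3 j (Sum.inr w) = ⊤ := by
    intro j w hw
    have hw3 : ((3 : ℕ) : 𝓞 ℚ) ∈ w.asIdeal := KolyvaginPrime.natCast_mem_asIdeal_of_primesEquiv_eq hw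
    exact propagatedSelmerStructure_three_eq_top_of_torsion_eq_zero W w hw3 (ht0 w hw3) redT hredT j
  -- the two-exponent witness package at the two depths + (COMP), value rows from `hvalue`
  obtain ⟨κf, κu, h₁, h₂, h₃⟩ :=
    exists_katoKuriharaWitnessAtTwoExp_pair_of_zetaBody W P hbody hirr hkk' red hred hv₃ (hΛ k) (hΛ k')
      (hfin₂ k) (hfin₂ k') D hT D' hT' hC hC' hPr hPr' hKol hKol' hbad (htop k) (htop k')
      (fun σ hI hχ r hr => hvalue k σ hI hχ r (fun q hq => hPr (hr (Finset.mem_coe.2 hq)))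
        (fun q hq => hKol q (hr (Finset.mem_coe.2 hq)))
        (fun q hq => hC.zpowers_eq_top (hr (Finset.mem_coe.2 hq))))
      (fun σ hI hχ r hr => hvalue k' σ hI hχ r (fun q hq => hPr' (hr (Finset.mem_coe.2 hq)))
        (fun q hq => hKol' q (hr (Finset.mem_coe.2 hq)))
        (fun q hq => hC'.zpowers_eq_top (hr (Finset.mem_coe.2 hq))))
  exact ⟨κf, Λfin k, κf, κu, Λfin k', κu, h₁, h₂, fun l hl' hl => ⟨h₃ l hl' hl, h₃ l hl' hl⟩⟩

/-- **★₂′: ★₂ with the value rows DISCHARGED** — PORT₂ `KatoKuriharaPortThreeAtWith₂TwoExp W 0 e v₃ η P` from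
`ZetaBody` (displayed `hbody`), the (Λ)-clauses `hΛ`, the two-exponent riders `hfin₂`, `hcdA`, THEOREM D's
certificates `hbad`/`ht0`, and the level-free VALUE certificates of n1011's T-PK6-VDIS (`hirr`, `hNorm`/`hκ0` —
Kato's constant a rational `3`-unit in the coordinate of the bound witnesses, `d′`/`hcd`/`hdd′`, `hAN`, `hpN`,
`aM`/`haM`, `hE0`/`hE`, `hR0`/`hR`) — ★₂ ∘ `ValueRow.valueRows_of_zetaBody` (`hf := P.isNewformOf`, `t := 0`).
The additive-defect twin of n1011's `katoKuriharaPortThreeAtWith₂_zero_of_zetaBody_of_valueRows`.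
[cite: Kato2004Asterisque, §9.4 (p. 188), Thm. 9.7 (p. 189), Thm. 6.6 (1) (p. 163) and Ex. 13.3 (pp. 224–225)]
[cite: Kim2022StructureSelmer, Thm. 3.13 and its proof (arXiv v3 pp. 12, 26–28)] [cite: Kim2025RefinedTNC, §4.2 and §8.1.2] -/
theorem katoKuriharaPortThreeAtWith₂TwoExp_zero_of_zetaBody_of_valueRows
    {N : ℕ} [NeZero N] (P : ModularParametrizationData W N) (hN : N = W.conductorNorm ℤ)
    {ι : (n : ℕ) → (CyclotomicField n ℚ →+* ℂ)} {κK : ℝ}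
    {Λ : ∀ (k' : ℕ) (r : Finset (HeightOneSpectrum (𝓞 ℚ))),
      H1 (tateRep W 3) (cycSubgroup 3 k' r) →ₗ[ℤ_[3]] ℚ_[3] ⊗[ℚ] CyclotomicField (cycLevel 3 k' r) ℚ}
    {c d a : ℤ} {A : ℕ} [NeZero A]
    {z : ∀ (k' : ℕ) (r : (cyclotomicLevelsRat 3 (badPlaces c d A N)).Ideals),
      H1 (tateRep W 3) ((cyclotomicLevelsRat 3 (badPlaces c d A N)).level k' r.1)}
    {x : ∀ (k' : ℕ) (r : (cyclotomicLevelsRat 3 (badPlaces c d A N)).Ideals),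
      CyclotomicField (cycLevel 3 k' r.1) ℚ}
    (hbody : ZetaBody W 3 P.f ι κK Λ c d a A z x)
    {e : ℕ} {v₃ : HeightOneSpectrum (𝓞 ℚ)}
    (Λfin : ∀ j : ℕ, galoisCohomology ((W.torsionGaloisModule (((3 : ℕ) : ℤ) ^ j * ((3 : ℕ) : ℤ))).toLocal
      (Sum.inr v₃)) 1 →+ ZMod (3 ^ (j + 1)))
    (hΛ : ∀ j : ℕ,
      (∀ c : ZMod (3 ^ (j + 1)), ∃ x ∈ propagatedSelmerStructure W 3 j (Sum.inr v₃), Λfin j x = c) ∧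
      (∀ x ∈ propagatedSelmerStructure W 3 j (Sum.inr v₃),
        Λfin j x = 0 ↔ x ∈ W.kummerSelmerStructure (((3 : ℕ) : ℤ) ^ j * ((3 : ℕ) : ℤ)) (Sum.inr v₃)))
    (hfin₂ : ∀ j : ℕ, RIDER₂⟦W, j, 0, e, v₃, Λ, Λfin j⟧)
    {η : (q : HeightOneSpectrum (𝓞 ℚ)) → (ZMod (Ideal.absNorm q.asIdeal))ˣ}
    (hcdA : ∀ q : ℕ, q.Prime → q ≡ 1 [MOD 3] → ¬ q ∣ 2 * c.natAbs * d.natAbs * A)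
    (hbad : ∀ w : HeightOneSpectrum (𝓞 ℚ), ¬ W.HasGoodReductionAt w →
      ((primesEquiv w : Nat.Primes) : ℕ) ≠ 3 →
        ∀ Q : (W.baseChange (w.adicCompletion ℚ)).toAffine.Point, 3 • Q = 0 → Q = 0)
    (ht0 : ∀ w : HeightOneSpectrum (𝓞 ℚ), ((3 : ℕ) : 𝓞 ℚ) ∈ w.asIdeal →
        ∀ Q : (W.baseChange (w.adicCompletion ℚ)).toAffine.Point, 3 • Q = 0 → Q = 0)
    -- the VALUE certificates (T-PK6-VDIS), replacing ★₂'s displayed `hvalue`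
    (hirr : W.HasIrreducibleModPGaloisRep 3)
    (hNorm : ∃ u : ℚ, (u : ℝ) = κK ∧ padicValRat 3 u = 0) (hκ0 : κK ≠ 0)
    (d' : ℤ) (hcd : Int.gcd (c * d) A = 1) (hdd' : d * d' ≡ 1 [ZMOD (A : ℤ)])
    (hAN : Nat.Coprime A N) (hpN : 3 ^ 2 ∣ N)
    (aM : ℕ → ℤ) (haM : ∀ q ∈ (3 * A).primeFactors, cuspCoeff P.f q = aM q)
    (hE0 : ∏ q ∈ (3 * A).primeFactors, (1 - (aM q : ℚ) / q + (if q ∣ N then 0 else (1 / q : ℚ))) ≠ 0)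
    (hE : padicValRat 3
      (∏ q ∈ (3 * A).primeFactors, (1 - (aM q : ℚ) / q + (if q ∣ N then 0 else (1 / q : ℚ)))) = 0)
    (hR0 : (c : ℚ) ^ 2 * (d : ℚ) ^ 2 * ratMinusSymbol P.f ((a : ℚ) / A) -
        (c : ℚ) * (d : ℚ) ^ 2 * ratMinusSymbol P.f ((a * c : ℚ) / A) -
        (c : ℚ) ^ 2 * (d : ℚ) * ratMinusSymbol P.f ((a * d' : ℚ) / A) +
        (c : ℚ) * (d : ℚ) * ratMinusSymbol P.f ((a * c * d' : ℚ) / A) ≠ 0)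
    (hR : padicValRat 3 ((c : ℚ) ^ 2 * (d : ℚ) ^ 2 * ratMinusSymbol P.f ((a : ℚ) / A) -
        (c : ℚ) * (d : ℚ) ^ 2 * ratMinusSymbol P.f ((a * c : ℚ) / A) -
        (c : ℚ) ^ 2 * (d : ℚ) * ratMinusSymbol P.f ((a * d' : ℚ) / A) +
        (c : ℚ) * (d : ℚ) * ratMinusSymbol P.f ((a * c * d' : ℚ) / A)) = 0) :
    KatoKuriharaPortThreeAtWith₂TwoExp W 0 e v₃ η P :=
  katoKuriharaPortThreeAtWith₂TwoExp_zero_of_zetaBody W P hN hbody Λfin hΛ hfin₂ hcdA hbad ht0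
    (ValueRow.valueRows_of_zetaBody hbody P.isNewformOf (by decide) hirr hNorm hκ0 d' hcd hdd' hAN hpN
      aM haM hE0 hE hR0 hR η)

/-! ### Certification (appended, seat acc6 gen 2): at `e = 0` the displayed clauses ARE n1011's rider -/

omit [W.IsGloballyMinimal] [Module.Free ℤ_[3] (W.tateModule 3)] [Module.Finite ℤ_[3] (W.tateModule 3)] in
/-- **At `e = 0` the (Λ)-clauses + the two-exponent clause (ii₂) are EXACTLY n1011's rider `KatoExpStarFiniteLevelAt`**
(`3^0 · x = x`): nothing displayed by ★₂ / ★₂′ is stronger than what ★ PK-6₂ displays on the Kato stratum.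
[cite: Kim2022StructureSelmer, §3.3 (Lemma 3.11, Prop. 3.12) and the proof of Thm. 3.13 (arXiv v3 pp. 26–27)] -/
theorem lambdaClauses_and_rider₂_zero_of_katoExpStarFiniteLevelAt {j t : ℕ} {v₃ : HeightOneSpectrum (𝓞 ℚ)}
    {Λ : ∀ (k' : ℕ) (r : Finset (HeightOneSpectrum (𝓞 ℚ))),
      H1 (tateRep W 3) (cycSubgroup 3 k' r) →ₗ[ℤ_[3]] ℚ_[3] ⊗[ℚ] CyclotomicField (cycLevel 3 k' r) ℚ}
    {Λf : galoisCohomology ((W.torsionGaloisModule (((3 : ℕ) : ℤ) ^ j * ((3 : ℕ) : ℤ))).toLocal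
      (Sum.inr v₃)) 1 →+ ZMod (3 ^ (j + 1))}
    (h : KatoExpStarFiniteLevelAt W 3 j t v₃ Λ Λf) :
    ((∀ c : ZMod (3 ^ (j + 1)), ∃ x ∈ propagatedSelmerStructure W 3 j (Sum.inr v₃), Λf x = c) ∧
      (∀ x ∈ propagatedSelmerStructure W 3 j (Sum.inr v₃),
        Λf x = 0 ↔ x ∈ W.kummerSelmerStructure (((3 : ℕ) : ℤ) ^ j * ((3 : ℕ) : ℤ)) (Sum.inr v₃))) ∧
    RIDER₂⟦W, j, t, 0, v₃, Λ, Λf⟧ := by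
  refine ⟨⟨h.1, h.2.1⟩, fun r Ψ hΨ y κ₀ s hres hloc hval => ?_⟩
  rw [pow_zero, Nat.cast_one, one_mul]
  exact h.2.2 r Ψ hΨ y κ₀ s hres hloc hval

set_option backward.isDefEq.respectTransparency false in
/-- **★ PK-6₂'s displayed inputs give PORT₂ at `e = 0` on ANY row** — ★₂ fed n1011's rider through the certification: this
is PORT″'s conclusion WITHOUT PORT″'s antecedents `¬ 3 ∣ c₃` / `¬ 3 ∣ c_P` / period (which ★ PK-6₂ never read), in seat acc6's
currency `KatoKuriharaPortThreeAtWith₂TwoExp W 0 0 v₃ η P`; compare `KimAtThreeKolyvaginDefs.katoKuriharaPortThreeAtWith₂TwoExp_zero_of_portThreeAtWith₂`.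
[cite: Kato2004Asterisque, §9.4 (p. 188), Thm. 9.7 (p. 189) and Ex. 13.3 (pp. 224–225)]
[cite: Kim2022StructureSelmer, Thm. 3.13 and §3.3–§3.4.1 (arXiv v3 pp. 17–18, 26–27)] -/
theorem katoKuriharaPortThreeAtWith₂TwoExp_zero_zero_of_zetaBody
    {N : ℕ} [NeZero N] (P : ModularParametrizationData W N) (hN : N = W.conductorNorm ℤ)
    {ι : (n : ℕ) → (CyclotomicField n ℚ →+* ℂ)} {κK : ℝ}
    {Λ : ∀ (k' : ℕ) (r : Finset (HeightOneSpectrum (𝓞 ℚ))),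
      H1 (tateRep W 3) (cycSubgroup 3 k' r) →ₗ[ℤ_[3]] ℚ_[3] ⊗[ℚ] CyclotomicField (cycLevel 3 k' r) ℚ}
    {c d a : ℤ} {A : ℕ}
    {z : ∀ (k' : ℕ) (r : (cyclotomicLevelsRat 3 (badPlaces c d A N)).Ideals),
      H1 (tateRep W 3) ((cyclotomicLevelsRat 3 (badPlaces c d A N)).level k' r.1)}
    {x : ∀ (k' : ℕ) (r : (cyclotomicLevelsRat 3 (badPlaces c d A N)).Ideals),
      CyclotomicField (cycLevel 3 k' r.1) ℚ}
    (hbody : ZetaBody W 3 P.f ι κK Λ c d a A z x)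
    {v₃ : HeightOneSpectrum (𝓞 ℚ)}
    (Λfin : ∀ j : ℕ, galoisCohomology ((W.torsionGaloisModule (((3 : ℕ) : ℤ) ^ j * ((3 : ℕ) : ℤ))).toLocal
      (Sum.inr v₃)) 1 →+ ZMod (3 ^ (j + 1)))
    (hfin : ∀ j : ℕ, KatoExpStarFiniteLevelAt W 3 j 0 v₃ Λ (Λfin j))
    {η : (q : HeightOneSpectrum (𝓞 ℚ)) → (ZMod (Ideal.absNorm q.asIdeal))ˣ}
    (hcdA : ∀ q : ℕ, q.Prime → q ≡ 1 [MOD 3] → ¬ q ∣ 2 * c.natAbs * d.natAbs * A)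
    (hbad : ∀ w : HeightOneSpectrum (𝓞 ℚ), ¬ W.HasGoodReductionAt w →
      ((primesEquiv w : Nat.Primes) : ℕ) ≠ 3 →
        ∀ Q : (W.baseChange (w.adicCompletion ℚ)).toAffine.Point, 3 • Q = 0 → Q = 0)
    (ht0 : ∀ w : HeightOneSpectrum (𝓞 ℚ), ((3 : ℕ) : 𝓞 ℚ) ∈ w.asIdeal →
        ∀ Q : (W.baseChange (w.adicCompletion ℚ)).toAffine.Point, 3 • Q = 0 → Q = 0)
    (hvalue : ∀ (j : ℕ) (σ : HeightOneSpectrum (𝓞 ℚ) → absoluteGaloisGroup ℚ),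
      (∀ q, σ q ∈ (adicCompletionPrime ℚ q).inertia (absoluteGaloisGroup ℚ)) →
      (∀ q, modNCyclotomicCharacter ℚ (Ideal.absNorm q.asIdeal) (σ q) = η q) →
      ∀ (r : Finset (HeightOneSpectrum (𝓞 ℚ)))
        (hr : ∀ q ∈ r, q ∈ (cyclotomicLevelsRat 3 (badPlaces c d A N)).primes),
        (∀ q ∈ r, Kato.IsKolyvaginPrime W 3 (j + 1) ((primesEquiv q : Nat.Primes) : ℕ)) →
        (∀ q ∈ r, Subgroup.zpowers (η q) = ⊤) →
        ∃ (s : ℤ_[3]) (u : (ZMod (3 ^ (j + 1)))ˣ)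
          (ψ : (ℓ : ℕ) → (ZMod ℓ)ˣ →* Multiplicative (ZMod (3 ^ (j + 1)))),
          (∀ q ∈ r, Function.Surjective (ψ (Ideal.absNorm q.asIdeal))) ∧
          (∃ l ∈ cycIntLattice 3 (cycLevel 3 0 r),
            (((3 : ℕ) : ℤ_[3]) ^ (0 : ℕ)) • ((1 : ℚ_[3]) ⊗ₜ[ℚ]
              ((r.noncommProd 𝐃F⟦r, σ⟧ (ZetaValue.pairwise_commute_fieldDeriv (cycLevel 3 0 r)
                  (fun ℓ => modNCyclotomicCharacter ℚ (cycLevel 3 0 r) (σ ℓ))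
                  (fun ℓ => ((primesEquiv ℓ : Nat.Primes) : ℕ) - 1) r))
                (x 0 ⟨r, hr⟩ + sigma (cycLevel 3 0 r) (-1) (x 0 ⟨r, hr⟩)))) -
              ((s : ℚ_[3]) ⊗ₜ[ℚ] (1 : CyclotomicField (cycLevel 3 0 r) ℚ)) =
            (((3 : ℕ) : ℤ_[3]) ^ (j + 1)) • (l : ℚ_[3] ⊗[ℚ] CyclotomicField (cycLevel 3 0 r) ℚ)) ∧
          haveI : NeZero (∏ q ∈ r, Ideal.absNorm q.asIdeal) :=
            ⟨Finset.prod_ne_zero_iff.2 fun q _ h => q.ne_bot (Ideal.absNorm_eq_zero_iff.1 h)⟩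
          PadicInt.toZModPow (j + 1) s = (u : ZMod (3 ^ (j + 1))) *
            ((3 : ℕ) : ZMod (3 ^ (j + 1))) ^ (0 : ℕ) *
              kuriharaNumber P.f (3 ^ (j + 1)) (∏ q ∈ r, Ideal.absNorm q.asIdeal) ψ) :
    KatoKuriharaPortThreeAtWith₂TwoExp W 0 0 v₃ η P :=
  katoKuriharaPortThreeAtWith₂TwoExp_zero_of_zetaBody W P hN hbody Λfin
    (fun j => (lambdaClauses_and_rider₂_zero_of_katoExpStarFiniteLevelAt W (hfin j)).1)
    (fun j => (lambdaClauses_and_rider₂_zero_of_katoExpStarFiniteLevelAt W (hfin j)).2) hcdA hbad ht0 hvalue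

end Summit.BirchSwinnertonDyer.BirchSwinnertonDyer.Theorems.KimAtThreeTwoExponentPortOfZetaBody

end
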